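import Summits.Ventures.PercRepro.RLSRuleTwoLinesT1B
import Summits.Ventures.PercRepro.RLSPlanesT2_1

/-!
# C-025 at q = 3: `R₃⁺` on the plane «two `3`-point lines through a point» at `t = 2` and at EVERY type (night-3, gen 4)

* `t = 2` (`ρ(E ∖ G) = p − 2`, `|K| = n + 2`, `ρ(E) ≥ p`): no line of `G` lies in `cl(E ∖ G)`
  (`not_line_subset_closure_compl_of_rank`), so there is no loss; the demand is at most `8` (the independent triples:
  a bottom set misses two points) and the pure form `8r₀ + 16r₁ + 8r₂ ≥ 8Φ` (`U2.Planes1.plane6_t2`) closes it;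
* `t ≥ 3`: the demand is `0`.

**`perFlat_twoLines_all`**: on `Core M (n + 4)`, `n ≥ 4`, every `TwoLines` plane satisfies the per-flat inequality of
`R₃⁺` — `t = 0` by `perFlat_twoLines`, `t = 1` by `perFlat_twoLines_t1`, `t = 2` by `perFlat_twoLines_t2`.  With
`perFlat_three_line_point_all` this is the second of the six `𝒯₀` planes settled at every type on the core.
Imports `RLSRuleTwoLinesT1B`, the landed table `RLSPlanesT2_1`.  Axioms: standard.
-/

open scoped Matroid

namespace PercRepro

namespace NightThree

open Finset ThmH PerFlat

variable {α : Type*} [DecidableEq α] {M : Matroid α} [M.Finite]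

/-! ### `t = 2`: no line in `cl(E ∖ G)`, the pure form -/

open scoped Classical in
/-- **`R₃⁺` at `t = 2` on the plane «two `3`-point lines through a point»**, every `p = n + 4 ≥ 8`, `ρ(E) ≥ p`: no
line of `G` lies in `cl(E ∖ G)`, so every witness is good; the demand is at most `8` (the independent triples) and the
pure form `8r₀ + 16r₁ + 8r₂ ≥ 8Φ` (`U2.Planes1.plane6_t2`) closes it. -/
theorem perFlat_twoLines_t2 {G ℓ ℓ' : Finset α} {n : ℕ} (hG : G ∈ flatsQ M 3) (h : TwoLines M G ℓ ℓ')
    (hn : 4 ≤ n) (hK : M.eRk ((gr M \ G : Finset α) : Set α) = ((n + 2 : ℕ) : ℕ∞))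
    (hr : ((n + 4 : ℕ) : ℕ∞) ≤ M.eRank) :
    phiK (n + 4) 3 * ((UqG M (n + 4) 3 G).card : ℚ) ≤ ∑ S ∈ Yq M (n + 4) 3, wPlus M G S := by
  obtain ⟨K, hKsub, hKind, hKcard⟩ := exists_indep_compl_card G (p := n + 2) (le_of_eq hK.symm)
  have hKG : Disjoint K G := by
    rw [Finset.disjoint_left]
    intro x hxK hxG
    have := hKsub hxK
    rw [Finset.mem_sdiff] at this
    exact this.2 hxG
  obtain ⟨hmem3, h𝔅rank, hd34, hd5, hc3, hc4⟩ := twoLines_family hG h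
  obtain ⟨hℓG, hℓ'G, hℓc, hℓ'c, hℓr, hℓ'r, hne, hGc, hsimple, hind⟩ := h
  have h' : TwoLines M G ℓ ℓ' := ⟨hℓG, hℓ'G, hℓc, hℓ'c, hℓr, hℓ'r, hne, hGc, hsimple, hind⟩
  have hGE : G ⊆ gr M := (mem_flatsQ.1 hG).1
  have hlt : M.eRk ((gr M \ G : Finset α) : Set α) + 1 < M.eRank := by
    rw [hK]
    calc ((n + 2 : ℕ) : ℕ∞) + 1 = ((n + 3 : ℕ) : ℕ∞) := by push_cast; ring
      _ < ((n + 4 : ℕ) : ℕ∞) := by exact_mod_cast (by omega : n + 3 < n + 4)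
      _ ≤ M.eRank := hr
  -- no line of `G` inside `cl(E ∖ G)`: every witness is good
  have hnot : ∀ m : Finset α, m ⊆ G → m.card = 3 → ¬ (m : Set α) ⊆ M.closure ((gr M \ G : Finset α) : Set α) := by
    intro m hmG hmc
    obtain ⟨g, hg⟩ : ∃ g, g ∈ G \ m := by
      apply Finset.card_pos.1
      rw [Finset.card_sdiff_of_subset hmG, hGc, hmc]
      norm_num
    rw [Finset.mem_sdiff] at hg
    apply not_line_subset_closure_compl_of_rank hG hmG hg.1 _ hlt
    have hsub : insert g m ⊆ G := Finset.insert_subset hg.1 hmG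
    have hc4' : (insert g m).card = 4 := by rw [Finset.card_insert_of_notMem hg.2, hmc]
    exact (h𝔅rank _ (by rw [Finset.mem_union, Finset.mem_union]; exact Or.inl (Or.inr
      (Finset.mem_powersetCard.2 ⟨hsub, hc4'⟩)))).2
  have hgood : ∀ m : Finset α, m ⊆ G → m.card = 3 → ∀ X, GoodWitness M m K X := by
    intro m hmG hmc X C hC
    have hmE : (m : Set α) ⊆ M.E := by
      rw [← coe_gr M]; exact Finset.coe_subset.2 (hmG.trans hGE)
    rw [coplanarTriples_eq_empty_of_not_subset hmE hKsub hKind (hnot m hmG hmc)] at hC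
    exact absurd hC (Finset.notMem_empty C)
  have hnotboth : ∀ B ∈ G.powersetCard 4, ¬ (ℓ ⊆ B ∧ ℓ' ⊆ B) := by
    rintro B hB ⟨hl, hl'⟩
    have : ℓ ∪ ℓ' ⊆ B := Finset.union_subset hl hl'
    rw [union_eq_of_twoLines hG h'] at this
    have := Finset.card_le_card this
    rw [(Finset.mem_powersetCard.1 hB).2] at this
    omega
  -- the demand: at most `8`
  have hdem : ((UqG M (n + 4) 3 G).card : ℚ) ≤ 8 := by
    have := Finset.card_le_card (UqG_subset_of_twoLines_t2 h' hK)
    rw [hc3] at this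
    exact_mod_cast this
  -- the crude shares
  set f : Finset α → Finset α → ℚ := fun B X =>
    ((B.card.choose 3 - (if ℓ ⊆ B then 1 else 0) - (if ℓ' ⊆ B then 1 else 0) : ℕ) : ℚ) /
      (((B.card + X.card).choose 3 : ℕ) : ℚ) with hf
  have hsup := supply_ge_of_family hG h𝔅rank hKsub hKind n f (fun B hB X hX => by
    obtain ⟨hXK, _, _⟩ := mem_witnessFamily hX
    have hXind : M.Indep (X : Set α) := hKind.subset (Finset.coe_subset.2 hXK)
    have hXG : Disjoint X G := Finset.disjoint_of_subset_left hXK hKG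
    have hBG := (h𝔅rank B hB).1
    exact wPlus_ge_of_twoLines hG h' hBG hXind hXG hXK
      ⟨fun _ => hgood ℓ hℓG hℓc X, fun _ => hgood ℓ' hℓ'G hℓ'c X⟩)
  -- the sums (`|K| = n + 2`)
  have hw0 : ∑ X ∈ witnessFamily K n, 1 / (((3 + X.card).choose 3 : ℕ) : ℚ) = U2.r0Sum n := by
    rw [sum_witnessFamily K n (fun x => 1 / (((3 + x).choose 3 : ℕ) : ℚ)), hKcard]
    unfold U2.r0Sum
    apply Finset.sum_congr rfl
    intro i _
    rw [show 3 + (i + 1) = i + 4 by omega]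
    ring
  have hw1 : ∀ c : ℚ, ∑ X ∈ witnessFamily K n, c / (((4 + X.card).choose 3 : ℕ) : ℚ) = c * U2.r1Sum n := by
    intro c
    rw [sum_witnessFamily K n (fun x => c / (((4 + x).choose 3 : ℕ) : ℚ)), hKcard]
    unfold U2.r1Sum
    rw [Finset.mul_sum]
    apply Finset.sum_congr rfl
    intro i _
    rw [show 4 + (i + 1) = i + 5 by omega]
    ring
  have hw2 : ∑ X ∈ witnessFamily K n, 8 / (((5 + X.card).choose 3 : ℕ) : ℚ) = 8 * U2.r2Sum n := by
    rw [sum_witnessFamily K n (fun x => 8 / (((5 + x).choose 3 : ℕ) : ℚ)), hKcard]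
    unfold U2.r2Sum
    rw [Finset.mul_sum]
    apply Finset.sum_congr rfl
    intro i _
    rw [show 5 + (i + 1) = i + 6 by omega]
    ring
  have h3 : ∑ B ∈ ((G.powersetCard 3).erase ℓ).erase ℓ', ∑ X ∈ witnessFamily K n, f B X = 8 * U2.r0Sum n := by
    have hval : ∀ B ∈ ((G.powersetCard 3).erase ℓ).erase ℓ', ∑ X ∈ witnessFamily K n, f B X = U2.r0Sum n := by
      intro B hB
      obtain ⟨_, hBc, hl, hl', _⟩ := hmem3 B hB
      have : ∀ X ∈ witnessFamily K n, f B X = 1 / (((3 + X.card).choose 3 : ℕ) : ℚ) := by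
        intro X _
        rw [hf]
        dsimp only
        rw [hBc]
        simp only [if_neg hl, if_neg hl', Nat.choose_self, Nat.sub_zero, Nat.cast_one]
      rw [Finset.sum_congr rfl this, hw0]
    rw [Finset.sum_congr rfl hval, Finset.sum_const, hc3, nsmul_eq_mul]
    norm_num
  have h4 : ∑ B ∈ G.powersetCard 4, ∑ X ∈ witnessFamily K n, f B X =
      2 * (3 * U2.r1Sum n) + 2 * (3 * U2.r1Sum n) + 4 * U2.r1Sum n := by
    apply sum_powersetCard_four_twoLines hG h'
    · intro B hB hl
      have hBc := (Finset.mem_powersetCard.1 hB).2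
      have hl' : ¬ ℓ' ⊆ B := fun hl' => hnotboth B hB ⟨hl, hl'⟩
      have hval : ∀ X ∈ witnessFamily K n, f B X = 3 / (((4 + X.card).choose 3 : ℕ) : ℚ) := by
        intro X _
        rw [hf]
        dsimp only
        rw [hBc, show Nat.choose 4 3 = 4 by norm_num [Nat.choose]]
        simp only [if_pos hl, if_neg hl', Nat.sub_zero]
        norm_num
      rw [Finset.sum_congr rfl hval, hw1]
    · intro B hB hl'
      have hBc := (Finset.mem_powersetCard.1 hB).2
      have hl : ¬ ℓ ⊆ B := fun hl => hnotboth B hB ⟨hl, hl'⟩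
      have hval : ∀ X ∈ witnessFamily K n, f B X = 3 / (((4 + X.card).choose 3 : ℕ) : ℚ) := by
        intro X _
        rw [hf]
        dsimp only
        rw [hBc, show Nat.choose 4 3 = 4 by norm_num [Nat.choose]]
        simp only [if_neg hl, if_pos hl', Nat.sub_zero]
        norm_num
      rw [Finset.sum_congr rfl hval, hw1]
    · intro B hB hl hl'
      have hBc := (Finset.mem_powersetCard.1 hB).2
      have hval : ∀ X ∈ witnessFamily K n, f B X = 4 / (((4 + X.card).choose 3 : ℕ) : ℚ) := by
        intro X _
        rw [hf]
        dsimp only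
        rw [hBc, show Nat.choose 4 3 = 4 by norm_num [Nat.choose]]
        simp only [if_neg hl, if_neg hl', Nat.sub_zero]
        norm_num
      rw [Finset.sum_congr rfl hval, hw1]
  have h5 : ∑ X ∈ witnessFamily K n, f G X = 8 * U2.r2Sum n := by
    have hval : ∀ X ∈ witnessFamily K n, f G X = 8 / (((5 + X.card).choose 3 : ℕ) : ℚ) := by
      intro X _
      rw [hf]
      dsimp only
      rw [hGc, show Nat.choose 5 3 = 10 by norm_num [Nat.choose]]
      simp only [if_pos hℓG, if_pos hℓ'G]
      norm_num
    rw [Finset.sum_congr rfl hval, hw2]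
  have hphi : phiK (n + 4) 3 = ∑ i ∈ range n, ((n + 4).choose (i + 1) : ℚ) / ((i + 4).choose 3 : ℚ) := by
    unfold phiK
    rw [phiW_eq_phiK_form n]
    rfl
  have hcert := U2.Planes1.plane6_t2 n hn
  rw [← hphi] at hcert
  calc phiK (n + 4) 3 * ((UqG M (n + 4) 3 G).card : ℚ)
      ≤ phiK (n + 4) 3 * 8 := mul_le_mul_of_nonneg_left hdem (phiK_nonneg _ _)
    _ ≤ 8 * U2.r0Sum n + 16 * U2.r1Sum n + 8 * U2.r2Sum n := hcert
    _ = ∑ B ∈ ((G.powersetCard 3).erase ℓ).erase ℓ' ∪ G.powersetCard 4 ∪ {G},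
          ∑ X ∈ witnessFamily K n, f B X := by
        rw [Finset.sum_union hd5, Finset.sum_union hd34, Finset.sum_singleton, h3, h4, h5]
        ring
    _ ≤ ∑ S ∈ Yq M (n + 4) 3, wPlus M G S := hsup

/-! ### Every type on the core -/

open scoped Classical in
/-- **`R₃⁺` on the plane «two `3`-point lines through a point» at EVERY type**, every `p = n + 4 ≥ 8`, on a core
matroid: `t = 0` by `perFlat_twoLines`, `t = 1` by `perFlat_twoLines_t1`, `t = 2` by `perFlat_twoLines_t2`, `t ≥ 3` by
the vanishing demand. -/
theorem perFlat_twoLines_all {G ℓ ℓ' : Finset α} {n : ℕ} (hc : Core M (n + 4)) (hG : G ∈ flatsQ M 3)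
    (h : TwoLines M G ℓ ℓ') (hn : 4 ≤ n) :
    phiK (n + 4) 3 * ((UqG M (n + 4) 3 G).card : ℚ) ≤ ∑ S ∈ Yq M (n + 4) 3, wPlus M G S := by
  obtain ⟨e, he, _⟩ := eRk_eq_nat M (gr M \ G)
  rcases le_or_gt (n + 4) e with h0 | h0
  · exact perFlat_twoLines hG h hn (by rw [he]; exact_mod_cast h0)
  rcases Nat.lt_or_ge e (n + 2) with h3 | h2
  · -- `t ≥ 3`: no demand
    have hdem := card_UqG_le_of_eRk_compl G (p := n + 4) (t := 3) he (by omega)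
    have h0' : demandCount G.card 3 = 0 := by
      rw [h.2.2.2.2.2.2.2.1]
      unfold demandCount
      norm_num [Finset.sum_range_succ]
    rw [h0'] at hdem
    have hU : ((UqG M (n + 4) 3 G).card : ℚ) = 0 := le_antisymm hdem (by positivity)
    rw [hU, mul_zero]
    exact Finset.sum_nonneg (fun S _ => wPlus_nonneg M G S)
  rcases Nat.lt_or_ge e (n + 3) with h2' | h1
  · have he' : e = n + 2 := by omega
    exact perFlat_twoLines_t2 hG h hn (by rw [he, he']) (by rw [hc.2.1])
  · have he' : e = n + 3 := by omega
    exact perFlat_twoLines_t1 hG h hn (by rw [he, he'])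

end NightThree

end PercRepro
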